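import Literature.Probability.RandomPlanarGeometry.HexParafermion
import Literature.Probability.RandomPlanarGeometry.HexSAW
import Literature.Probability.LatticeModels.TriangularLatticeProofs
import Literature.Probability.Percolation.TriLoopWinding
import HarnessLib

/-!
# Crux `SAWDevelopingMap.ObservableToSLE` (stmt-CriticalPhenomena-10472), line
`floor-ratio-restriction-bootstrap`: structural helpers for the anchor stub `stub_shortChordLocality`

Landing target:
`Summits/CriticalPhenomena/SAWScalingLimit/Theorems/SAWDevelopingMapObservableToSLEShortChordLocalityHelpers.lean`
(`--supports stmt-CriticalPhenomena-10472`).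

The registered stub `stub_shortChordLocality` (SHORT-CHORD LOCALITY, lattice units) says: for every
`ε > 0` there is `K > 0` such that for all `n ≥ 1`, every simply connected hexagonal vertex domain
`Λ` lying strictly above the horizontal line through a boundary mid-edge `s`, containing the upper
half-box of radius `2Kn` around `mid s`, and every boundary mid-edge `t ≠ s` on that line with
`|mid s - mid t| ≤ n`, the `x_c`-mass of the self-avoiding walks `s → t` in `Λ` having a vertex at
distance `≥ Kn` from `mid s` is at most `ε` times their total `x_c`-mass.  As mathematics this is an
OPEN uniform arch-locality estimate for critical half-plane self-avoiding walks.  This file proves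
the two structural facts that reduce it to a statement about HALF-PLANE ARCHES only:

* **domain monotonicity** (`exists_injective_verts_eq`, `sum_verts_le_of_subset`,
  `archMass_mono`, `farArchMass_mono`): for `Λ ⊆ Λ'` the walks `s → t` in `Λ` inject into those in
  `Λ'` with the same vertex list, so every nonnegative functional of the vertex list — the total
  critical mass `Z_Λ(s,t) = Σ_γ x_c^{ℓ(γ)}` and the far mass — is monotone in the domain (this is
  the exact lattice restriction property `Z_{Λ'} ≤ Z_Λ` of the self-avoiding walk);
* **the reduction** (`shortChordLocality_of_halfPlaneArchTightness`): the registered statement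
  follows from HALF-PLANE ARCH TIGHTNESS — "for every finite `Λ` strictly above the line through
  `mid s` (a finite piece of the upper half-plane), the far mass of the arches `s → t` in `Λ` is at
  most `ε` times the total mass of the arches `s → t` inside the upper half-box `B⁺(2Kn)`" — by
  taking the half-box `B = {v ∈ Λ : |c_v - mid s| ≤ 2Kn}` and monotonicity `Z_B ≤ Z_Λ`.  The
  half-plane arch tightness is stated INLINE as the hypothesis of the reduction theorem (no new
  definition); it is the precise missing estimate of the line's anchor;
* **the dictionary** for vertical floor mid-edges `s_x = {(x - e₁, 1), (x, 0)}`: the floor line is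
  `Im = x₁ √3/2` (`im_hexMidpoint_floorEdge`) and "strictly above the floor line" means "in the
  rows `≥ x₁`" (`im_hexMidpoint_lt_im_hexCenter_iff`, `forall_im_lt_of_rows`, `rows_of_forall_im_lt`),
  the hypothesis under which the sibling file bounds the arch masses by `1/cos(3π/8)`.
-/

noncomputable section

open scoped BigOperators Classical
open Literature.Probability.LatticeModels (HexVertex hexGraph hexCenter triEmbed triZeta Site
  triZeta_re triZeta_im)
open Literature.Probability.RandomPlanarGeometry
open Literature.Probability.RandomPlanarGeometry.SAW
open Literature.Probability.Percolation (hexCenter_im)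

namespace Summit.CriticalPhenomena.SAWScalingLimit.Theorems.ObservableToSLE.FloorRatio

/-! ### Domain monotonicity of mid-edge self-avoiding walks -/

/-- The mid-edges of a domain increase with its vertex set: `Λ ⊆ Λ' ⟹ Ω(Λ) ⊆ Ω(Λ')`.
[cite: DuminilCopinSmirnov2012, §2 (domains)] -/
theorem hexDomainMidEdges_mono {Λ Λ' : Finset HexVertex} (h : Λ ⊆ Λ') :
    hexDomainMidEdges Λ ⊆ hexDomainMidEdges Λ' := by
  rintro e ⟨he, v, hv, hvΛ⟩
  exact ⟨he, v, hv, h hvΛ⟩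

/-- **Exact restriction (injection form).**  For `Λ ⊆ Λ'` the self-avoiding walks `s → t` in the
smaller domain are, with the same vertex list, self-avoiding walks `s → t` in the larger one: there
is an injection `HexMidEdgeSAW Λ s t → HexMidEdgeSAW Λ' s t` preserving `verts` (hence the length,
the visited set and every event measurable with respect to the trajectory).
[cite: LawlerSchrammWerner2004SAW, §3.4 ("SAW satisfies restriction")] -/
theorem exists_injective_verts_eq {Λ Λ' : Finset HexVertex} (h : Λ ⊆ Λ')
    (s t : Sym2 HexVertex) :
    ∃ ι : HexMidEdgeSAW Λ s t → HexMidEdgeSAW Λ' s t,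
      Function.Injective ι ∧ ∀ γ, (ι γ).verts = γ.verts := by
  refine ⟨fun γ => ⟨γ.verts, fun v hv => h (γ.subset v hv), γ.nodup, γ.isChain, γ.head_mem,
    γ.getLast_mem, γ.eq_of_nil, γ.edges_nodup, hexDomainMidEdges_mono h γ.fst_mem⟩,
    fun γ₁ γ₂ hγ => ?_, fun _ => rfl⟩
  exact HexMidEdgeSAW.ext (by simpa using congrArg HexMidEdgeSAW.verts hγ)

/-- **Exact restriction (monotonicity of nonnegative trajectory functionals).**  For `Λ ⊆ Λ'` and
any nonnegative function `w` of the vertex list, `Σ_{γ ⊂ Λ : s → t} w(γ) ≤ Σ_{γ ⊂ Λ' : s → t} w(γ)`.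
[cite: LawlerSchrammWerner2004SAW, §3.4 ("SAW satisfies restriction")] -/
theorem sum_verts_le_of_subset {Λ Λ' : Finset HexVertex} (h : Λ ⊆ Λ') (s t : Sym2 HexVertex)
    (w : List HexVertex → ℝ) (hw : ∀ l, 0 ≤ w l) :
    ∑ γ : HexMidEdgeSAW Λ s t, w γ.verts ≤ ∑ γ : HexMidEdgeSAW Λ' s t, w γ.verts := by
  obtain ⟨ι, hι, hv⟩ := exists_injective_verts_eq h s t
  calc ∑ γ : HexMidEdgeSAW Λ s t, w γ.verts
      = ∑ γ : HexMidEdgeSAW Λ s t, w (ι γ).verts := by simp_rw [hv]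
    _ = ∑ γ' ∈ (Finset.univ : Finset (HexMidEdgeSAW Λ s t)).map ⟨ι, hι⟩, w γ'.verts := by
        rw [Finset.sum_map]; rfl
    _ ≤ ∑ γ' : HexMidEdgeSAW Λ' s t, w γ'.verts :=
        Finset.sum_le_sum_of_subset_of_nonneg (Finset.subset_univ _) fun _ _ _ => hw _

/-- **The critical arch mass is monotone in the domain**: `Z_Λ(s,t) ≤ Z_{Λ'}(s,t)` for `Λ ⊆ Λ'`,
where `Z_Λ(s,t) = Σ_{γ ⊂ Λ : s → t} x_c^{ℓ(γ)}`.
[cite: LawlerSchrammWerner2004SAW, §3.4 ("SAW satisfies restriction")] -/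
theorem archMass_mono {Λ Λ' : Finset HexVertex} (h : Λ ⊆ Λ') (s t : Sym2 HexVertex) :
    ∑ γ : HexMidEdgeSAW Λ s t, hexCriticalFugacity ^ γ.length ≤
      ∑ γ : HexMidEdgeSAW Λ' s t, hexCriticalFugacity ^ γ.length :=
  sum_verts_le_of_subset h s t (fun l => hexCriticalFugacity ^ l.length)
    fun _ => pow_nonneg hexCriticalFugacity_pos_lt_one.1.le _

/-- **The far arch mass is monotone in the domain**: for `Λ ⊆ Λ'` and any threshold `R`, the
`x_c`-mass of the walks `s → t` in `Λ` visiting a vertex at distance `≥ R` from `mid s` is at most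
the same mass computed in `Λ'`. [cite: LawlerSchrammWerner2004SAW, §3.4 ("SAW satisfies restriction")] -/
theorem farArchMass_mono {Λ Λ' : Finset HexVertex} (h : Λ ⊆ Λ') (s t : Sym2 HexVertex) (R : ℝ) :
    (∑ γ : HexMidEdgeSAW Λ s t,
        if ∃ v ∈ γ.verts, R ≤ dist (hexCenter v) (hexMidpoint s)
        then hexCriticalFugacity ^ γ.length else 0) ≤
      ∑ γ : HexMidEdgeSAW Λ' s t,
        if ∃ v ∈ γ.verts, R ≤ dist (hexCenter v) (hexMidpoint s)
        then hexCriticalFugacity ^ γ.length else 0 := by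
  refine sum_verts_le_of_subset h s t
    (fun l => if ∃ v ∈ l, R ≤ dist (hexCenter v) (hexMidpoint s)
      then hexCriticalFugacity ^ l.length else 0) fun l => ?_
  split_ifs
  · exact pow_nonneg hexCriticalFugacity_pos_lt_one.1.le _
  · exact le_rfl

/-- The far arch mass is at most the total arch mass (same domain).
[cite: DuminilCopinSmirnov2012, §1] -/
theorem farArchMass_le_archMass (Λ : Finset HexVertex) (s t : Sym2 HexVertex) (R : ℝ) :
    (∑ γ : HexMidEdgeSAW Λ s t,
        if ∃ v ∈ γ.verts, R ≤ dist (hexCenter v) (hexMidpoint s)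
        then hexCriticalFugacity ^ γ.length else 0) ≤
      ∑ γ : HexMidEdgeSAW Λ s t, hexCriticalFugacity ^ γ.length := by
  refine Finset.sum_le_sum fun γ _ => ?_
  split_ifs
  · exact le_rfl
  · exact pow_nonneg hexCriticalFugacity_pos_lt_one.1.le _

/-- The total arch mass is nonnegative. [cite: DuminilCopinSmirnov2012, §1] -/
theorem archMass_nonneg (Λ : Finset HexVertex) (s t : Sym2 HexVertex) :
    0 ≤ ∑ γ : HexMidEdgeSAW Λ s t, hexCriticalFugacity ^ γ.length :=
  Finset.sum_nonneg fun _ _ => pow_nonneg hexCriticalFugacity_pos_lt_one.1.le _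

/-! ### The half-box of a domain above its floor line -/

/-- **The half-box inside a floor-supported domain.**  If `Λ` lies strictly above the horizontal
line through `mid s` and contains every vertex above that line within distance `R` of `mid s`,
then the part of `Λ` within distance `R` of `mid s` IS the upper half-box of radius `R`.
[cite: DuminilCopinSmirnov2012, §2 (domains)] -/
theorem mem_filter_dist_iff {Λ : Finset HexVertex} {s : Sym2 HexVertex} {R : ℝ}
    (habove : ∀ v ∈ Λ, (hexMidpoint s).im < (hexCenter v).im)
    (hbox : ∀ v : HexVertex, (hexMidpoint s).im < (hexCenter v).im →
      dist (hexCenter v) (hexMidpoint s) ≤ R → v ∈ Λ) (v : HexVertex) :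
    v ∈ Λ.filter (fun v => dist (hexCenter v) (hexMidpoint s) ≤ R) ↔
      ((hexMidpoint s).im < (hexCenter v).im ∧ dist (hexCenter v) (hexMidpoint s) ≤ R) := by
  rw [Finset.mem_filter]
  exact ⟨fun h => ⟨habove v h.1, h.2⟩, fun h => ⟨hbox v h.1 h.2, h.2⟩⟩

/-! ### The reduction to half-plane arch tightness -/

/-- **SHORT-CHORD LOCALITY FROM HALF-PLANE ARCH TIGHTNESS (the reduction).**  The hypothesis is
*half-plane arch tightness*: for every `ε > 0` there is `K > 0` such that for all `n ≥ 1`, every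
FINITE vertex set `Λ` lying strictly above the horizontal line through the boundary mid-edge `s`
(a finite piece of the upper half-plane at `s`), every boundary mid-edge `t ≠ s` on that line with
`|mid s - mid t| ≤ n`, and `B` the upper half-box of radius `2Kn` around `mid s`, the `x_c`-mass of
the arches `s → t` in `Λ` with a vertex at distance `≥ Kn` from `mid s` is at most `ε · Z_B(s,t)`.
The conclusion is the registered statement of `stub_shortChordLocality` verbatim: given `Λ` simply
connected, above the line and containing the half-box, take `B := {v ∈ Λ : |c_v - mid s| ≤ 2Kn}`
(which is the half-box, `mem_filter_dist_iff`) and use `Z_B ≤ Z_Λ` (`archMass_mono`).  Simple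
connectivity of `Λ` is not used. [cite: LawlerSchrammWerner2004SAW, §3.4 ("SAW satisfies restriction")] -/
theorem shortChordLocality_of_halfPlaneArchTightness
    (H : ∀ ε : ℝ, 0 < ε → ∃ K : ℝ, 0 < K ∧ ∀ (n : ℕ), 1 ≤ n → ∀ (Λ B : Finset HexVertex)
      (s t : Sym2 HexVertex),
      s ∈ hexDomainBoundary Λ → t ∈ hexDomainBoundary Λ → s ≠ t →
      dist (hexMidpoint s) (hexMidpoint t) ≤ n →
      (hexMidpoint t).im = (hexMidpoint s).im →
      (∀ v ∈ Λ, (hexMidpoint s).im < (hexCenter v).im) →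
      (∀ v : HexVertex, v ∈ B ↔ ((hexMidpoint s).im < (hexCenter v).im ∧
        dist (hexCenter v) (hexMidpoint s) ≤ 2 * K * n)) →
      (∑ γ : HexMidEdgeSAW Λ s t,
          if ∃ v ∈ γ.verts, K * n ≤ dist (hexCenter v) (hexMidpoint s)
          then hexCriticalFugacity ^ γ.length else 0) ≤
        ε * ∑ γ : HexMidEdgeSAW B s t, hexCriticalFugacity ^ γ.length) :
    ∀ ε : ℝ, 0 < ε → ∃ K : ℝ, 0 < K ∧ ∀ (n : ℕ), 1 ≤ n → ∀ (Λ : Finset HexVertex)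
      (s t : Sym2 HexVertex), hexDomainSimplyConnected Λ →
      s ∈ hexDomainBoundary Λ → t ∈ hexDomainBoundary Λ → s ≠ t →
      dist (hexMidpoint s) (hexMidpoint t) ≤ n →
      (hexMidpoint t).im = (hexMidpoint s).im →
      (∀ v ∈ Λ, (hexMidpoint s).im < (hexCenter v).im) →
      (∀ v : HexVertex, (hexMidpoint s).im < (hexCenter v).im →
        dist (hexCenter v) (hexMidpoint s) ≤ 2 * K * n → v ∈ Λ) →
      (∑ γ : HexMidEdgeSAW Λ s t,
          if ∃ v ∈ γ.verts, K * n ≤ dist (hexCenter v) (hexMidpoint s)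
          then hexCriticalFugacity ^ γ.length else 0) ≤
        ε * ∑ γ : HexMidEdgeSAW Λ s t, hexCriticalFugacity ^ γ.length := by
  intro ε hε
  obtain ⟨K, hK, hmain⟩ := H ε hε
  refine ⟨K, hK, fun n hn Λ s t _ hs ht hst hdist him habove hbox => ?_⟩
  set B := Λ.filter (fun v => dist (hexCenter v) (hexMidpoint s) ≤ 2 * K * n) with hB
  have hBsub : B ⊆ Λ := Finset.filter_subset _ _
  calc _ ≤ ε * ∑ γ : HexMidEdgeSAW B s t, hexCriticalFugacity ^ γ.length :=
        hmain n hn Λ B s t hs ht hst hdist him habove (mem_filter_dist_iff habove hbox)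
    _ ≤ ε * ∑ γ : HexMidEdgeSAW Λ s t, hexCriticalFugacity ^ γ.length :=
        mul_le_mul_of_nonneg_left (archMass_mono hBsub s t) hε.le

/-- **The converse direction of the sandwich (for the record).**  Short-chord locality in a domain
`Λ` above the line and containing the half-box bounds the far mass in `Λ` by `ε · Z_Λ(s,t)`; since
the far mass is monotone and `B⁺(2Kn) ⊆ Λ`, the far mass of the HALF-BOX arches is then also at
most `ε · Z_Λ(s,t)`.  (Together with the reduction this shows the registered statement and
half-plane arch tightness differ only in which total mass — `Z_Λ` or `Z_{B⁺(2Kn)}` — normalises.)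
[cite: LawlerSchrammWerner2004SAW, §3.4 ("SAW satisfies restriction")] -/
theorem farArchMass_halfBox_le {Λ B : Finset HexVertex} {s t : Sym2 HexVertex} {R ε : ℝ}
    (hBΛ : B ⊆ Λ)
    (hfar : (∑ γ : HexMidEdgeSAW Λ s t,
        if ∃ v ∈ γ.verts, R ≤ dist (hexCenter v) (hexMidpoint s)
        then hexCriticalFugacity ^ γ.length else 0) ≤
      ε * ∑ γ : HexMidEdgeSAW Λ s t, hexCriticalFugacity ^ γ.length) :
    (∑ γ : HexMidEdgeSAW B s t,
        if ∃ v ∈ γ.verts, R ≤ dist (hexCenter v) (hexMidpoint s)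
        then hexCriticalFugacity ^ γ.length else 0) ≤
      ε * ∑ γ : HexMidEdgeSAW Λ s t, hexCriticalFugacity ^ γ.length :=
  (farArchMass_mono hBΛ s t R).trans hfar

/-! ### Dictionary: the geometric floor hypotheses of the stub for vertical floor mid-edges -/

/-- **The floor line.**  The midpoint of the vertical floor mid-edge `s_x = {(x - e₁, 1), (x, 0)}`
has imaginary part `x₁ · (√3/2)`: the floor line of the row `x₁`. [folklore] -/
theorem im_hexMidpoint_floorEdge (x : Site 2) :
    (hexMidpoint s((x - Pi.single 1 1, 1), (x, 0))).im = (x 1 : ℝ) * (Real.sqrt 3 / 2) := by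
  rw [hexMidpoint_mk, Complex.div_ofNat_im, Complex.add_im, hexCenter_im, hexCenter_im]
  simp only [Pi.sub_apply, Pi.single_eq_same, Int.cast_sub, Int.cast_one, Fin.isValue,
    Fin.val_one, Nat.cast_one, Fin.val_zero, Nat.cast_zero]
  ring

/-- **"Strictly above the floor line" = "in the rows `≥ x₁`".**  A face centre lies strictly above
the horizontal line through `mid s_x` iff its cell is in a row `≥ x₁`; hence the stub's hypothesis
`∀ v ∈ Λ, Im(mid s) < Im(c_v)` for a vertical floor mid-edge `s = s_x` says exactly that `Λ` is
contained in the rows `≥ x₁` (the hypothesis of `sum_floorArchMass_le`). [folklore] -/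
theorem im_hexMidpoint_lt_im_hexCenter_iff (x y : Site 2) (i : Fin 2) :
    (hexMidpoint s((x - Pi.single 1 1, 1), (x, 0))).im < (hexCenter (y, i)).im ↔ x 1 ≤ y 1 := by
  rw [im_hexMidpoint_floorEdge, hexCenter_im]
  have hs : (0 : ℝ) < Real.sqrt 3 / 2 := by positivity
  have hi : (0 : ℝ) ≤ ((i : ℕ) : ℝ) ∧ ((i : ℕ) : ℝ) ≤ 1 := by
    fin_cases i <;> simp
  constructor
  · intro h
    have h' : (x 1 : ℝ) < (y 1 : ℝ) + ((i : ℕ) + 1) / 3 := lt_of_mul_lt_mul_right h hs.le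
    by_contra hlt
    push Not at hlt
    have h1 : y 1 + 1 ≤ x 1 := hlt
    have h2 : ((y 1 + 1 : ℤ) : ℝ) ≤ x 1 := by exact_mod_cast h1
    push_cast at h2
    linarith [hi.2]
  · intro h
    have : (x 1 : ℝ) ≤ y 1 := by exact_mod_cast h
    apply mul_lt_mul_of_pos_right _ hs
    linarith [hi.1]

/-- For `Λ` in the rows `≥ x₁`, the stub's geometric hypothesis holds for `s = s_x`:
every vertex of `Λ` lies strictly above the floor line. [folklore] -/
theorem forall_im_lt_of_rows {Λ : Finset HexVertex} {x : Site 2} (hΛ : ∀ v ∈ Λ, x 1 ≤ v.1 1) :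
    ∀ v ∈ Λ, (hexMidpoint s((x - Pi.single 1 1, 1), (x, 0))).im < (hexCenter v).im := by
  rintro ⟨y, i⟩ hv
  exact (im_hexMidpoint_lt_im_hexCenter_iff x y i).2 (hΛ _ hv)

/-- Conversely, the stub's geometric hypothesis for `s = s_x` puts `Λ` in the rows `≥ x₁`.
[folklore] -/
theorem rows_of_forall_im_lt {Λ : Finset HexVertex} {x : Site 2}
    (h : ∀ v ∈ Λ, (hexMidpoint s((x - Pi.single 1 1, 1), (x, 0))).im < (hexCenter v).im) :
    ∀ v ∈ Λ, x 1 ≤ v.1 1 := by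
  rintro ⟨y, i⟩ hv
  exact (im_hexMidpoint_lt_im_hexCenter_iff x y i).1 (h _ hv)

/-! ### Registered form of the reduction (sub-goal of `stub_shortChordLocality`) -/

/-- **Registered sub-goal `stub_shortChordLocality_reduction`** (crux item stmt-CriticalPhenomena-10472,
line `floor-ratio-restriction-bootstrap`, anchor stub `stub_shortChordLocality`): HALF-PLANE ARCH
TIGHTNESS implies the registered SHORT-CHORD LOCALITY statement verbatim
(`shortChordLocality_of_halfPlaneArchTightness`).  The antecedent is the precise missing estimate
of the anchor. [cite: LawlerSchrammWerner2004SAW, §3.4 ("SAW satisfies restriction")] -/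
theorem stub_shortChordLocality_reduction :
    (∀ ε : ℝ, 0 < ε → ∃ K : ℝ, 0 < K ∧ ∀ (n : ℕ), 1 ≤ n → ∀ (Λ B : Finset HexVertex)
      (s t : Sym2 HexVertex), s ∈ hexDomainBoundary Λ → t ∈ hexDomainBoundary Λ → s ≠ t →
      dist (hexMidpoint s) (hexMidpoint t) ≤ n → (hexMidpoint t).im = (hexMidpoint s).im →
      (∀ v ∈ Λ, (hexMidpoint s).im < (hexCenter v).im) →
      (∀ v : HexVertex, v ∈ B ↔ ((hexMidpoint s).im < (hexCenter v).im ∧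
        dist (hexCenter v) (hexMidpoint s) ≤ 2 * K * n)) →
      (∑ γ : HexMidEdgeSAW Λ s t, if ∃ v ∈ γ.verts, K * n ≤ dist (hexCenter v) (hexMidpoint s)
        then hexCriticalFugacity ^ γ.length else 0) ≤
      ε * ∑ γ : HexMidEdgeSAW B s t, hexCriticalFugacity ^ γ.length) →
    ∀ ε : ℝ, 0 < ε → ∃ K : ℝ, 0 < K ∧ ∀ (n : ℕ), 1 ≤ n → ∀ (Λ : Finset HexVertex)
      (s t : Sym2 HexVertex), hexDomainSimplyConnected Λ →
      s ∈ hexDomainBoundary Λ → t ∈ hexDomainBoundary Λ → s ≠ t →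
      dist (hexMidpoint s) (hexMidpoint t) ≤ n → (hexMidpoint t).im = (hexMidpoint s).im →
      (∀ v ∈ Λ, (hexMidpoint s).im < (hexCenter v).im) →
      (∀ v : HexVertex, (hexMidpoint s).im < (hexCenter v).im →
        dist (hexCenter v) (hexMidpoint s) ≤ 2 * K * n → v ∈ Λ) →
      (∑ γ : HexMidEdgeSAW Λ s t, if ∃ v ∈ γ.verts, K * n ≤ dist (hexCenter v) (hexMidpoint s)
        then hexCriticalFugacity ^ γ.length else 0) ≤
      ε * ∑ γ : HexMidEdgeSAW Λ s t, hexCriticalFugacity ^ γ.length :=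
  shortChordLocality_of_halfPlaneArchTightness

end Summit.CriticalPhenomena.SAWScalingLimit.Theorems.ObservableToSLE.FloorRatio

end
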